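import Mathlib
import Literature.AlgebraicGeometry.Resolution.FormalInverseFunction
import Summits.ResolutionOfSingularities.ResolutionOfSingularities.Theorems.WeightedInvariantLocalWeightedDropSpaceCountGame

/-!
# `WeightedInvariant.LocalWeightedDrop`, line `tame-four-tuple-drop`, stub (A3) piece (A3-α): INVARIANCE OF THE COUNT GAME under formal
# coordinate changes and units

Crux item stmt-ResolutionOfSingularities-8899 `LocalWeightedDrop` (route `ResolutionOfSingularities/WeightedInvariant`); strategist line
`tame-four-tuple-drop` (res-L1-w43-strat-1), stub (A3) `stub_spaceNonNCCountRad_of_CJS`, game layer (A3-α).  [OURS · L1 W4.3, chain w43, res-type-056;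
API for the transfer (A3-β) (res-type-088) and stub-4's brick B1, whose positions along the Cossart–Jannsen–Saito tower are germs read in Cohen frames
up to a unit and a frame change — the analogues of `won_subst_iff` / `won_unit_mul_iff` of the `Won`-transfer.  Nothing here is a statement of any
manuscript.]

* `winsIn_of_winsIn_subst` — `WinsIn P n (Ψ^* b) → WinsIn P n b` for a legal `Ψ` (prepend `Ψ` to the move: the transforms, hence the answers and the
  new positions, are the same series); needs only `P (Ψ^* b) → P b`.  (The converse direction needs the formal inverse of `Ψ` and is not provided.)
* `winsIn_unit_mul` — `WinsIn P n b → WinsIn P n (u · b)` for `u(0) ≠ 0` (same move; at an answer the `s`-saturations of `b` and `u·b` have the same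
  exponent and differ by the unit `u∘Φ(chart)`, `s` being prime; slices of units are units), given `P` is unit-invariant.
* `germIsNC_of_germIsNC_subst`, `germIsNC_unit_mul` — `GermIsNC` has both invariances, whence `winsIn_germIsNC_of_subst`, `winsIn_germIsNC_unit_mul`.
* `winsIn_of_dvd_pow_at` — RADICAL TRANSPORT AT A FIXED EXPONENT (arbiter res-L1-w43-strat-1 05:58:59Z (4)): with heredity of `P` at the single
  exponent `N`, `WinsIn P n d → b ∣ d^(N+1) → WinsIn P n b` (`d ≠ 0`) — saturating the cofactor too (`b·q = d^(N+1)` ⇒ `G_b·G_q = G_d^(N+1)` by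
  uniqueness of the `s`-saturation), the exponent does not grow; `depth_le_of_dvd_pow_at` is clause (ii) at that `N` (stub-4's T4 uses `N = 0`).
-/

set_option linter.dupNamespace false -- mandated namespace of this single-conjunct summit

namespace Summit.ResolutionOfSingularities.ResolutionOfSingularities.Theorems

namespace TameFourTupleDrop

open MvPowerSeries Literature.AlgebraicGeometry.Resolution

variable {k : Type} [Field k] {m : ℕ}

/-! ## Coordinate changes -/

/-- Prepending a legal coordinate change to a move gives a move. -/
theorem isCountMove_comp {Ψ Φ : Fin (m + 1) → MvPowerSeries (Fin (m + 1)) k} {w : Fin (m + 1) → ℕ}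
    (hΨ0 : ∀ i, constantCoeff (Ψ i) = 0) (hΨdet : IsUnit (Matrix.det (Matrix.of fun i j => coeff (Finsupp.single j 1) (Ψ i))))
    (hmv : IsCountMove Φ w) : IsCountMove (fun i => subst Φ (Ψ i)) w := by
  obtain ⟨hΦ0, hΦdet, hw1, hwpos⟩ := hmv
  refine ⟨constantCoeff_comp_eq_zero hΨ0 hΦ0, ?_, hw1, hwpos⟩
  change IsUnit (FormalCoordChange.linMat (fun i => subst Φ (Ψ i))).det
  rw [linMat_comp Ψ hΦ0, Matrix.det_mul]
  exact IsUnit.mul hΨdet hΦdet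

/-- The move clause of `Ψ^* b` under `Φ` is the move clause of `b` under `Φ ∘ Ψ` (same transforms). -/
theorem moveClause_subst_iff {b : MvPowerSeries (Fin (m + 1)) k} {Ψ Φ : Fin (m + 1) → MvPowerSeries (Fin (m + 1)) k}
    {w : Fin (m + 1) → ℕ} (hΨ0 : ∀ i, constantCoeff (Ψ i) = 0) (hΦ0 : ∀ i, constantCoeff (Φ i) = 0)
    (good : MvPowerSeries (Fin (m + 1)) k → Prop) :
    MoveClause (subst Ψ b) Φ w good ↔ MoveClause b (fun i => subst Φ (Ψ i)) w good := by
  unfold MoveClause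
  simp only [subst_subst_eq_subst_comp hΨ0 hΦ0 b]

/-- COORDINATE CHANGES (OURS · L1 W4.3, (A3-α) API): `WinsIn P n (Ψ^* b) → WinsIn P n b` for a legal `Ψ`, provided `P (Ψ^* b) → P b`. -/
theorem winsIn_of_winsIn_subst {P : MvPowerSeries (Fin (m + 1)) k → Prop}
    (hP : ∀ (b : MvPowerSeries (Fin (m + 1)) k) (Ψ : Fin (m + 1) → MvPowerSeries (Fin (m + 1)) k),
      (∀ i, constantCoeff (Ψ i) = 0) → IsUnit (Matrix.det (Matrix.of fun i j => coeff (Finsupp.single j 1) (Ψ i))) →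
      P (subst Ψ b) → P b)
    {Ψ : Fin (m + 1) → MvPowerSeries (Fin (m + 1)) k} (hΨ0 : ∀ i, constantCoeff (Ψ i) = 0)
    (hΨdet : IsUnit (Matrix.det (Matrix.of fun i j => coeff (Finsupp.single j 1) (Ψ i)))) :
    ∀ (n : ℕ) (b : MvPowerSeries (Fin (m + 1)) k), WinsIn P n (subst Ψ b) → WinsIn P n b := by
  intro n
  induction n with
  | zero => exact fun b h => hP b Ψ hΨ0 hΨdet h
  | succ n ih =>
    intro b h
    rcases h with h | ⟨Φ, w, hmv, hcl⟩
    · exact Or.inl (ih b h)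
    · exact Or.inr ⟨fun i => subst Φ (Ψ i), w, isCountMove_comp hΨ0 hΨdet hmv, (moveClause_subst_iff hΨ0 hmv.1 _).mp hcl⟩

/-- The converse, via the formal inverse function theorem: `WinsIn P n b → WinsIn P n (Ψ^* b)` for a legal `Ψ`, provided `P` descends along
every legal substitution (`P (Ψ′^* b′) → P b′`). -/
theorem winsIn_subst_of_winsIn {P : MvPowerSeries (Fin (m + 1)) k → Prop}
    (hP : ∀ (b : MvPowerSeries (Fin (m + 1)) k) (Ψ : Fin (m + 1) → MvPowerSeries (Fin (m + 1)) k),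
      (∀ i, constantCoeff (Ψ i) = 0) → IsUnit (Matrix.det (Matrix.of fun i j => coeff (Finsupp.single j 1) (Ψ i))) →
      P (subst Ψ b) → P b)
    {Ψ : Fin (m + 1) → MvPowerSeries (Fin (m + 1)) k} (hΨ0 : ∀ i, constantCoeff (Ψ i) = 0)
    (hΨdet : IsUnit (Matrix.det (Matrix.of fun i j => coeff (Finsupp.single j 1) (Ψ i))))
    (n : ℕ) (b : MvPowerSeries (Fin (m + 1)) k) (h : WinsIn P n b) : WinsIn P n (subst Ψ b) := by
  obtain ⟨ψ, hψ0, hψΨ, -⟩ := FormalCoordChange.exists_comp_inverse hΨ0 hΨdet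
  have hψdet : IsUnit (FormalCoordChange.linMat ψ).det := isUnit_det_linMat_of_comp_eq_X hψ0 hψΨ
  have hb : subst ψ (subst Ψ b) = b := subst_subst_of_comp_eq_X hΨ0 hψ0 hψΨ b
  refine winsIn_of_winsIn_subst hP hψ0 hψdet n (subst Ψ b) ?_
  rw [hb]
  exact h

/-! ## Units -/

/-- The constant term survives a legal substitution followed by a chart (all components vanish at the origin). -/
theorem constantCoeff_subst_chart_subst {Φ : Fin (m + 1) → MvPowerSeries (Fin (m + 1)) k} (hΦ0 : ∀ i, constantCoeff (Φ i) = 0)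
    {w : Fin (m + 1) → ℕ} {c : Fin (m + 1) → k} (hc : ∀ i, w i = 0 → c i = 0) (u : MvPowerSeries (Fin (m + 1)) k) :
    constantCoeff (subst (CobordantChart.chart w c) (subst Φ u)) = constantCoeff u := by
  have hch0 : ∀ i, constantCoeff (CobordantChart.chart w c i) = 0 := by
    intro i
    rw [CobordantChart.chart_apply]
    by_cases h : w i = 0
    · simp [h, hc i h, constantCoeff_X]
    · simp [constantCoeff_X, zero_pow h]
  rw [constantCoeff_subst_of_constantCoeff_zero _ hch0, constantCoeff_subst_of_constantCoeff_zero _ hΦ0]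

/-- A series with non-zero constant term is not divisible by `s`. -/
theorem not_X_dvd_of_constantCoeff_ne_zero {n : ℕ} {U : MvPowerSeries (Fin (n + 1)) k} (hU : constantCoeff U ≠ 0) : ¬ X 0 ∣ U := by
  rintro ⟨V, hV⟩
  apply hU
  rw [hV, map_mul, constantCoeff_X, zero_mul]

/-- UNIQUENESS OF THE `s`-SATURATION UP TO A UNIT: from `U · s^A G = s^{A′} G′` with `U(0) ≠ 0`, `s ∤ G`, `s ∤ G′`: `A = A′` and `G′ = U · G`. -/
theorem saturation_unit_mul {U G G' : MvPowerSeries (Fin (m + 1 + 1)) k} {A A' : ℕ} (hU : constantCoeff U ≠ 0)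
    (hG : ¬ X 0 ∣ G) (hG' : ¬ X 0 ∣ G') (h : U * (X 0 ^ A * G) = X 0 ^ A' * G') : A = A' ∧ G' = U * G := by
  have hprime := MvPowerSeries.prime_X' k (0 : Fin (m + 1 + 1))
  have hUG : ¬ X 0 ∣ U * G := fun hd => (hprime.dvd_or_dvd hd).elim (not_X_dvd_of_constantCoeff_ne_zero hU) hG
  have h' : X 0 ^ A * (U * G) = X 0 ^ A' * G' := by rw [← h]; ring
  have h1 : X 0 ^ A * (U * G) ∣ X 0 ^ A' * G' := ⟨1, by rw [h', mul_one]⟩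
  have h2 : X 0 ^ A' * G' ∣ X 0 ^ A * (U * G) := ⟨1, by rw [h', mul_one]⟩
  have hle := (dvd_of_X_pow_mul_dvd hG' h1).1
  have hge := (dvd_of_X_pow_mul_dvd hUG h2).1
  have hAA : A = A' := le_antisymm hle hge
  subst hAA
  exact ⟨rfl, (mul_left_cancel₀ (pow_ne_zero A hprime.ne_zero) h').symm⟩

/-- The slice `y′ᵢ ↦ 0` preserves constant terms. -/
theorem constantCoeff_slice (i : Fin (m + 1)) (U : MvPowerSeries (Fin (m + 1 + 1)) k) :
    constantCoeff (TupleGame.slice i U) = constantCoeff U := by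
  unfold TupleGame.slice
  exact constantCoeff_subst_of_constantCoeff_zero _ (fun j => by split_ifs <;> simp [constantCoeff_X]) U

/-- UNITS (OURS · L1 W4.3, (A3-α) API): `WinsIn P n b → WinsIn P n (u · b)` for `u(0) ≠ 0`, provided `P` is unit-invariant. -/
theorem winsIn_unit_mul {P : MvPowerSeries (Fin (m + 1)) k → Prop}
    (hP : ∀ b u : MvPowerSeries (Fin (m + 1)) k, constantCoeff u ≠ 0 → P b → P (u * b)) :
    ∀ (n : ℕ) (b u : MvPowerSeries (Fin (m + 1)) k), constantCoeff u ≠ 0 → WinsIn P n b → WinsIn P n (u * b) := by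
  intro n
  induction n with
  | zero => exact fun b u hu h => hP b u hu h
  | succ n ih =>
    intro b u hu h
    rcases h with h | ⟨Φ, w, hmv, hcl⟩
    · exact Or.inl (ih b u hu h)
    refine Or.inr ⟨Φ, w, hmv, ?_⟩
    intro c hc hc0 A' G' hfac' hG'
    obtain ⟨hΦ0, hdet, hw1, -⟩ := hmv
    have hΦs : HasSubst Φ := hasSubst_of_constantCoeff_zero hΦ0
    have hch := CobordantChart.hasSubst_chart w c hc
    have hprime := MvPowerSeries.prime_X' k (0 : Fin (m + 1 + 1))
    -- the transforms of `u` (a unit) and of `b`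
    set Uc := subst (CobordantChart.chart w c) (subst Φ u) with hUc
    have hUc0 : constantCoeff Uc ≠ 0 := by rw [hUc, constantCoeff_subst_chart_subst hΦ0 hc]; exact hu
    have hprod : subst (CobordantChart.chart w c) (subst Φ (u * b)) = Uc * subst (CobordantChart.chart w c) (subst Φ b) := by
      rw [hUc, ← coe_substAlgHom hΦs, ← coe_substAlgHom hch, map_mul, map_mul]
    by_cases hb : b = 0
    · exfalso
      apply hG'
      have : X 0 ^ A' * G' = 0 := by
        rw [← hfac', hprod, hb, ← coe_substAlgHom hΦs, map_zero, ← coe_substAlgHom hch, map_zero, mul_zero]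
      rcases mul_eq_zero.mp this with h0 | h0
      · exact absurd h0 (pow_ne_zero A' hprime.ne_zero)
      · rw [h0]; exact dvd_zero _
    have hT : subst (CobordantChart.chart w c) (subst Φ b) ≠ 0 :=
      CobordantChart.subst_chart_ne_zero w c hc (FormalCoordChange.subst_ne_zero_of_isUnit_det hΦ0 hdet hb)
    obtain ⟨A, G, hfac, hG⟩ := CobordantVertexChart.exists_eq_X_pow_mul_not_dvd hT
    have hsat : Uc * (X 0 ^ A * G) = X 0 ^ A' * G' := by rw [← hfac, ← hprod, hfac']
    obtain ⟨-, hG'eq⟩ := saturation_unit_mul hUc0 hG hG' hsat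
    obtain ⟨i, hci, hwin⟩ := hcl c hc hc0 A G hfac hG
    refine ⟨i, hci, ?_⟩
    have hpos : X 0 * TupleGame.slice i G' = TupleGame.slice i Uc * (X 0 * TupleGame.slice i G) := by
      rw [hG'eq, slice_mul]; ring
    rw [hpos]
    exact ih _ _ (by rw [constantCoeff_slice]; exact hUc0) hwin

/-! ## Radical transport at a fixed exponent -/

/-- RADICAL TRANSPORT AT A FIXED EXPONENT (OURS · L1 W4.3, (A3-α) API): if `P` is hereditary along `b ∣ d^(N+1)` for ONE exponent `N`, then so is
`WinsIn P n` for that `N`.  Compared with `winsIn_of_dvd_pow` the cofactor `q` (`b·q = d^(N+1)`) is `s`-saturated as well, so that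
`G_b · G_q = G_d^(N+1)` and the exponent is preserved through the move. -/
theorem winsIn_of_dvd_pow_at {P : MvPowerSeries (Fin (m + 1)) k → Prop} (N : ℕ)
    (hP : ∀ (b d : MvPowerSeries (Fin (m + 1)) k), d ≠ 0 → P d → b ∣ d ^ (N + 1) → P b) :
    ∀ (n : ℕ) (b d : MvPowerSeries (Fin (m + 1)) k), d ≠ 0 → WinsIn P n d → b ∣ d ^ (N + 1) → WinsIn P n b := by
  intro n
  induction n with
  | zero => exact fun b d hd hPd hbd => hP b d hd hPd hbd
  | succ n ih =>
    intro b d hd hwin hbd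
    rcases hwin with hwin | ⟨Φ, w, hmv, hclause⟩
    · exact Or.inl (ih b d hd hwin hbd)
    refine Or.inr ⟨Φ, w, hmv, ?_⟩
    intro c hc hc0 Ab Gb hfacb hGb
    obtain ⟨hΦ0, hdet, hw1, -⟩ := hmv
    have hΦs : HasSubst Φ := hasSubst_of_constantCoeff_zero hΦ0
    have hch := CobordantChart.hasSubst_chart w c hc
    have hprime := MvPowerSeries.prime_X' k (0 : Fin (m + 1 + 1))
    obtain ⟨q, hq⟩ := hbd
    have hq0 : q ≠ 0 := by
      rintro rfl
      rw [mul_zero] at hq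
      exact hd (pow_eq_zero_iff (Nat.succ_ne_zero N) |>.mp hq)
    -- transforms and saturations of `d` and of the cofactor `q`
    have hT : ∀ {f : MvPowerSeries (Fin (m + 1)) k}, f ≠ 0 → subst (CobordantChart.chart w c) (subst Φ f) ≠ 0 := fun hf =>
      CobordantChart.subst_chart_ne_zero w c hc (FormalCoordChange.subst_ne_zero_of_isUnit_det hΦ0 hdet hf)
    obtain ⟨Ad, Gd, hfacd, hGd⟩ := CobordantVertexChart.exists_eq_X_pow_mul_not_dvd (hT hd)
    obtain ⟨Aq, Gq, hfacq, hGq⟩ := CobordantVertexChart.exists_eq_X_pow_mul_not_dvd (hT hq0)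
    obtain ⟨i, hci, hwini⟩ := hclause c hc hc0 Ad Gd hfacd hGd
    refine ⟨i, hci, ?_⟩
    -- `s^{(N+1)A_d} G_d^{N+1} = s^{A_b + A_q} (G_b G_q)`, hence `G_d^{N+1} = G_b G_q`
    have hsat : (1 : MvPowerSeries (Fin (m + 1 + 1)) k) * (X 0 ^ (Ab + Aq) * (Gb * Gq)) = X 0 ^ (Ad * (N + 1)) * Gd ^ (N + 1) := by
      have hTd : (subst (CobordantChart.chart w c) (subst Φ d)) ^ (N + 1) =
          subst (CobordantChart.chart w c) (subst Φ b) * subst (CobordantChart.chart w c) (subst Φ q) := by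
        rw [← coe_substAlgHom hΦs, ← coe_substAlgHom hch, ← map_pow, ← map_pow, hq, map_mul, map_mul]
      rw [one_mul, pow_mul, ← mul_pow, ← hfacd, hTd, hfacb, hfacq]
      ring
    have hGbq : ¬ X 0 ∣ Gb * Gq := fun h => (hprime.dvd_or_dvd h).elim hGb hGq
    obtain ⟨-, hGeq⟩ := saturation_unit_mul (by rw [map_one]; exact one_ne_zero) hGbq (not_X_dvd_pow hGd (N + 1)) hsat
    rw [one_mul] at hGeq
    -- the sliced positions: `s · Gb| ∣ (s · Gd|)^(N+1)`
    have hslice : X 0 * TupleGame.slice i Gb ∣ (X 0 * TupleGame.slice i Gd) ^ (N + 1) := by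
      refine ⟨X 0 ^ N * TupleGame.slice i Gq, ?_⟩
      have hs := congrArg (TupleGame.slice i) hGeq
      rw [slice_pow, slice_mul] at hs
      calc (X 0 * TupleGame.slice i Gd) ^ (N + 1) = X 0 ^ (N + 1) * TupleGame.slice i Gd ^ (N + 1) := mul_pow _ _ _
        _ = X 0 ^ (N + 1) * (TupleGame.slice i Gb * TupleGame.slice i Gq) := by rw [hs]
        _ = X 0 * TupleGame.slice i Gb * (X 0 ^ N * TupleGame.slice i Gq) := by ring
    have hne : X 0 * TupleGame.slice i Gd ≠ 0 :=
      mul_ne_zero (MvPowerSeries.prime_X' k (0 : Fin (m + 1))).ne_zero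
        (TupleDropAssembly.slice_ne_zero (subst Φ d) w c hc hw1 Ad Gd hfacd hGd i hci)
    exact ih _ _ hne hwini hslice

/-- Clause (ii) at a fixed exponent: with heredity of `P` along `b ∣ d^(N+1)` for one `N`, `depth b ≤ depth d` whenever `b ∣ d^(N+1)`, `d ≠ 0`
(stub-4's T4: `N = 0`, `P b := b.order < 2`, plain-divisor heredity). -/
theorem depth_le_of_dvd_pow_at {P : MvPowerSeries (Fin (m + 1)) k → Prop}
    (htot : ∀ b : MvPowerSeries (Fin (m + 1)) k, b ≠ 0 → ∃ n, WinsIn P n b) (N : ℕ)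
    (hP : ∀ (b d : MvPowerSeries (Fin (m + 1)) k), d ≠ 0 → P d → b ∣ d ^ (N + 1) → P b)
    {b d : MvPowerSeries (Fin (m + 1)) k} (hd : d ≠ 0) (hbd : b ∣ d ^ (N + 1)) : depth P htot b ≤ depth P htot d :=
  depth_le P htot (winsIn_of_dvd_pow_at N hP _ b d hd (winsIn_depth P htot hd) hbd)

/-! ## `GermIsNC` is invariant -/

/-- `GermIsNC (Ψ^* b) → GermIsNC b` for a legal `Ψ` (prepend `Ψ` to the normalising coordinates). -/
theorem germIsNC_of_germIsNC_subst (b : MvPowerSeries (Fin (m + 1)) k) (Ψ : Fin (m + 1) → MvPowerSeries (Fin (m + 1)) k)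
    (hΨ0 : ∀ i, constantCoeff (Ψ i) = 0) (hΨdet : IsUnit (Matrix.det (Matrix.of fun i j => coeff (Finsupp.single j 1) (Ψ i))))
    (h : GermIsNC (subst Ψ b)) : GermIsNC b := by
  obtain ⟨Φ, u, e, hΦ0, hΦdet, hu, heq⟩ := h
  refine ⟨fun i => subst Φ (Ψ i), u, e, constantCoeff_comp_eq_zero hΨ0 hΦ0, ?_, hu, ?_⟩
  · change IsUnit (FormalCoordChange.linMat (fun i => subst Φ (Ψ i))).det
    rw [linMat_comp Ψ hΦ0, Matrix.det_mul]
    exact IsUnit.mul hΨdet hΦdet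
  · rw [← subst_subst_eq_subst_comp hΨ0 hΦ0 b]
    exact heq

/-- `GermIsNC b → GermIsNC (v · b)` for `v(0) ≠ 0`. -/
theorem germIsNC_unit_mul (b v : MvPowerSeries (Fin (m + 1)) k) (hv : constantCoeff v ≠ 0) (h : GermIsNC b) :
    GermIsNC (v * b) := by
  obtain ⟨Φ, u, e, hΦ0, hΦdet, hu, heq⟩ := h
  have hΦs : HasSubst Φ := hasSubst_of_constantCoeff_zero hΦ0
  refine ⟨Φ, subst Φ v * u, e, hΦ0, hΦdet, ?_, ?_⟩
  · rw [map_mul, constantCoeff_subst_of_constantCoeff_zero _ hΦ0]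
    exact mul_ne_zero hv hu
  · rw [← coe_substAlgHom hΦs, map_mul, coe_substAlgHom, heq, mul_assoc]

/-- `WinsIn GermIsNC n (Ψ^* b) → WinsIn GermIsNC n b`. -/
theorem winsIn_germIsNC_of_subst {Ψ : Fin (m + 1) → MvPowerSeries (Fin (m + 1)) k} (hΨ0 : ∀ i, constantCoeff (Ψ i) = 0)
    (hΨdet : IsUnit (Matrix.det (Matrix.of fun i j => coeff (Finsupp.single j 1) (Ψ i)))) (n : ℕ)
    (b : MvPowerSeries (Fin (m + 1)) k) (h : WinsIn GermIsNC n (subst Ψ b)) : WinsIn GermIsNC n b :=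
  winsIn_of_winsIn_subst (fun b Ψ hΨ0 hΨdet h => germIsNC_of_germIsNC_subst b Ψ hΨ0 hΨdet h) hΨ0 hΨdet n b h

/-- `WinsIn GermIsNC n b → WinsIn GermIsNC n (Ψ^* b)`. -/
theorem winsIn_germIsNC_subst {Ψ : Fin (m + 1) → MvPowerSeries (Fin (m + 1)) k} (hΨ0 : ∀ i, constantCoeff (Ψ i) = 0)
    (hΨdet : IsUnit (Matrix.det (Matrix.of fun i j => coeff (Finsupp.single j 1) (Ψ i)))) (n : ℕ)
    (b : MvPowerSeries (Fin (m + 1)) k) (h : WinsIn GermIsNC n b) : WinsIn GermIsNC n (subst Ψ b) :=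
  winsIn_subst_of_winsIn (fun b Ψ hΨ0 hΨdet h => germIsNC_of_germIsNC_subst b Ψ hΨ0 hΨdet h) hΨ0 hΨdet n b h

/-- `WinsIn GermIsNC n b → WinsIn GermIsNC n (u · b)` for `u(0) ≠ 0`. -/
theorem winsIn_germIsNC_unit_mul (n : ℕ) (b u : MvPowerSeries (Fin (m + 1)) k) (hu : constantCoeff u ≠ 0)
    (h : WinsIn GermIsNC n b) : WinsIn GermIsNC n (u * b) :=
  winsIn_unit_mul (fun b u hu h => germIsNC_unit_mul b u hu h) n b u hu h

end TameFourTupleDrop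

end Summit.ResolutionOfSingularities.ResolutionOfSingularities.Theorems
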